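import Literature.NumberTheory.Automorphic.ArchInnerFormChartMeasures           -- ★ p849748 (LH3-p02): `chartTorusG ∕ chartHaarG ∕ chartOrbG`, `chartTorusG_eq_centralizer`
import Literature.NumberTheory.Automorphic.ArchInnerFormCartanAtlasWeyl          -- ★ p849857 (LH4-p01) (NEGX-CONJ): `exists_involutive_conj_gprimeTorus_negXAt`
import Literature.NumberTheory.Automorphic.ArchInnerFormCartanAtlasSwap          -- ★ p849944 (LH4-p01) (SWAP-CONJ): `exists_involutive_conj_gprimeTorus_swap`
import Literature.MeasureTheory.Group.QuotientOrbitalNormalizerInvariance       -- ★ p849797 (LH2-p04) (β): `integral_descConj_conj_eq'`, `map_conj_eq_self_of_conj_conj_eq`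
import Literature.NumberTheory.Automorphic.ArchCartanCoordinates                -- ★ (COORD): `ArchCartan.negXAt`, `RegG`, `circleExp_ne_iff_forall_int`
import Literature.NumberTheory.Automorphic.ArchEndoscopicChartOrbFree             -- ★ B2 (LH2-p04): `exists_sub_mem_chartBox` (the box is fundamental for the period lattice)
import HarnessLib

/-!
# `chartTorusG` is exactly the chart points, and `chartOrbG` is EVEN in the split coordinate `x_w` (the realised real reflection of `G′_w = U(2,1)`) — the `G′`-side twin of
# ★ `ArchEndoscopicChartOrbWeyl` (Shelstad 1979 §4 pp. 22–23; Rogawski 1990 §3.6, §8.2; Knapp 1986 Ch. V §3; Deitmar–Echterhoff 2014 Thm. 1.5.3)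

Topic `NumberTheory/Automorphic`; namespace `Literature.NumberTheory.Automorphic.UnitaryGroup`.  THEOREMS ONLY (no definition, no instance, no notation, no axiom, no named fact, no
`sorry`).  Cell `pub/hodgecm-mathlib`, crux H413 (`stmt-HodgeConjecture-24833`), F0∕P3c line LH3 (closer stub `stub_N9`, DIRECT ROAD): organ (W-real-G′) (LH3-plan (g2) ruling (6)
2026-09-02T06:28:37Z; LH4-p01 (g2) (NEGX-CONJ) pointer 06:29:22Z), LH3-p02 (g2).  The split half of (W) for the genuine family `orbFamG` (★ `archRG` is even in `x_w`).

* §1 `exists_mem_regG` — every chart has a regular coordinate (`c w = (1, 2, 3)`: `x = 1 ≠ 0`; three angles pairwise `< 2π` apart).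
* §2 **`mem_chartTorusG_iff (hα) (hS′) (t) : t ∈ chartTorusG L α S′ ↔ ∃ c, gprimeTorus L α S′ c = t`** and `chartTorusG_eq_range` — the chart torus IS the set of chart
  points (at a regular coordinate `T_{S′} = Z(gprimeTorus c₀)` ★ `chartTorusG_eq_centralizer`, and that centraliser is the range ★ (CENT-G) `mem_centralizer_gprimeTorus_iff`);
  the `G′` twin of ★ B1 `mem_chartTorusH_iff`.
* §3 **`chartOrbG_negXAt (hα) (hS′) (hw : w ∈ S′) (a′) (c) : chartOrbG L α ν′ S′ a′ (negXAt w c) = chartOrbG L α ν′ S′ a′ c`** for EVERY `c` and every `a′` (Haar `ν′`): the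
  reflection is conjugation by an INVOLUTION `g ∈ G′_∞` (★ `exists_involutive_conj_gprimeTorus_negXAt`); `g` normalises `T_{S′}` (§2) and `Ad(g)` is involutive on it, so
  `Ad(g)_* dt′ = dt′` (★ `map_conj_eq_self_of_conj_conj_eq`) and the quotient orbital integral is unchanged (★ `integral_descConj_conj_eq'`); the box-mass prefactor is untouched.
* §4 (ED. 2) `iUnion_smul_chartBoxImgG_eq_univ`, **`nonempty_interior_chartBoxImgG`**, **`measure_chartBoxImgG_pos (t) [IsOpenPosMeasure t] : 0 < t B′`**, `chartHaarG_chartBoxImgG_pos`,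
  `toReal_chartHaarG_chartBoxImgG_pos` — the `G′` box is fundamental for the period lattice (★ B2 `exists_sub_mem_chartBox`), so by Baire it has interior and every Haar-type
  measure gives it POSITIVE mass: the junction scalar of ★ `classOrbitalIntegral_mul_measure_box_eq_chartOrbG` is non-zero (mirror of ★ B2 §2).
HONEST LABEL: HC_CM is proved only modulo the 7 printed citations (2 remaining: hLiu418 = `stmt-HodgeConjecture-24832`, h413 = `stmt-HodgeConjecture-24833`) until rung 0 closes;
* §5–§6 (ED. 3) **`chartOrbG_eq_of_involutive_conj`** (invariance under EVERY coordinate move realised by an involution of `G′_∞`) and **`chartOrbG_swap`** (same-sign compact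
  swaps, ★ (SWAP-CONJ) LH4-p01) — with §3 the whole REALISED Weyl group of the chart.
count-neutral (feeds (W) of the letter L1 for the genuine family and the READ junction).

## References
* [Shelstad1979] D. Shelstad, *Characters and inner forms of a quasi-split group over ℝ*, Compositio Math. 39 (1979), §4 pp. 22–23 ((II): `Ψ(γ^ω) = …` for REALISED `ω`).
* [Rogawski1990] J. D. Rogawski, *Automorphic Representations of Unitary Groups in Three Variables*, Ann. of Math. Stud. 123 (1990), §3.6 p. 31, §8.2 p. 122.
* [Knapp1986] A. W. Knapp, *Representation Theory of Semisimple Groups* (1986), Ch. V §3 (Weyl groups of the Cartans of `SU(2,1)`).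
* [DeitmarEchterhoff2014] A. Deitmar, S. Echterhoff, *Principles of Harmonic Analysis*, 2nd ed. (2014), Thm. 1.5.3.
-/

set_option autoImplicit false

noncomputable section

open MeasureTheory MeasureTheory.Measure NumberField NumberField.InfinitePlace Matrix Complex Topology
open Literature.MeasureTheory.Group Literature.NumberTheory.Automorphic.ArchCartan
open scoped MatrixGroups Matrix Classical

namespace Literature.NumberTheory.Automorphic.UnitaryGroup

/-! ## §1 Every chart has a regular coordinate -/

section RegWitness

variable {W : Type*}

/-- `Circle.exp a ≠ Circle.exp b` as soon as `0 < |a − b| < 2π`. [folklore] -/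
private theorem circleExp_ne_of_abs_sub_lt {a b : ℝ} (h0 : a ≠ b) (h : |a - b| < 2 * Real.pi) : Circle.exp a ≠ Circle.exp b := by
  rw [circleExp_ne_iff_forall_int]
  intro k hk
  rcases lt_trichotomy k 0 with hk0 | hk0 | hk0
  · have : (k : ℝ) ≤ -1 := by exact_mod_cast Int.le_sub_one_of_lt hk0
    have : a - b ≤ -(2 * Real.pi) := by rw [hk]; nlinarith [Real.pi_pos]
    linarith [neg_abs_le (a - b)]
  · subst hk0; simp at hk; exact h0 (sub_eq_zero.mp hk)
  · have : (1 : ℝ) ≤ k := by exact_mod_cast hk0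
    have : 2 * Real.pi ≤ a - b := by rw [hk]; nlinarith [Real.pi_pos]
    linarith [le_abs_self (a - b)]

/-- **Every chart label has a REGULAR coordinate**: `c w := (1, 2, 3)` at every place (`x_w = 1 ≠ 0` at split places; three angles pairwise distinct mod `2π` at compact places).
[cite: Shelstad1979, §4 p. 22] -/
theorem exists_mem_regG (S' : Finset W) : ∃ c : W → Fin 3 → ℝ, c ∈ RegG S' := by
  have hpi : (3 : ℝ) < 2 * Real.pi := by linarith [Real.pi_gt_three]
  have h01 : Circle.exp (1 : ℝ) ≠ Circle.exp 2 := circleExp_ne_of_abs_sub_lt (by norm_num) (by norm_num; linarith)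
  have h02 : Circle.exp (1 : ℝ) ≠ Circle.exp 3 := circleExp_ne_of_abs_sub_lt (by norm_num) (by norm_num; linarith)
  have h12 : Circle.exp (2 : ℝ) ≠ Circle.exp 3 := circleExp_ne_of_abs_sub_lt (by norm_num) (by norm_num; linarith)
  refine ⟨fun _ => ![1, 2, 3], fun w _ => ?_, fun w _ => by simp⟩
  intro i j hij
  fin_cases i <;> fin_cases j
  all_goals first | rfl | (exfalso; simp only [Fin.zero_eta, Fin.mk_one, Fin.isValue, Fin.reduceFinMk, Matrix.cons_val_zero, Matrix.cons_val_one,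
    Matrix.cons_val] at hij; first | exact h01 hij | exact h02 hij | exact h12 hij | exact h01 hij.symm | exact h02 hij.symm | exact h12 hij.symm)

end RegWitness

/-! ## §2 The chart torus is exactly the chart points -/

section Range

variable (L : Type) [Field L] [NumberField L] [IsCMField L] (α : Fin 3 → L) (S' : Finset {w : InfinitePlace L // IsComplex w})

/-- **`T_{S′}` IS EXACTLY THE CHART POINTS** (`α_i ≠ 0`, `S′` admissible): `t ∈ chartTorusG L α S′ ↔ ∃ c, gprimeTorus L α S′ c = t` — at a regular coordinate `c₀` (§1),
`T_{S′} = Z(gprimeTorus α S′ c₀)` (★ `chartTorusG_eq_centralizer`) and that centraliser is the set of chart points (★ (CENT-G) `mem_centralizer_gprimeTorus_iff`).  The `G′` twin of ★ B1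
`mem_chartTorusH_iff`. [cite: Rogawski1990, §3.6 p. 31] [cite: Shelstad1979, §4 p. 22] -/
theorem mem_chartTorusG_iff (hα : ∀ i, α i ≠ 0) (hS' : ∀ w, w ∈ S' → w ∈ splitChartPlaces L α) (t : ↥(arch (↥(maximalRealSubfield L)) L (IsCMField.complexConj L) 3 (Matrix.diagonal α))) :
    t ∈ chartTorusG L α S' ↔ ∃ c : {w : InfinitePlace L // IsComplex w} → Fin 3 → ℝ, gprimeTorus L α S' c = t := by
  obtain ⟨c₀, hc₀⟩ := exists_mem_regG (W := {w : InfinitePlace L // IsComplex w}) S'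
  rw [chartTorusG_eq_centralizer L α S' hα hS' hc₀, mem_centralizer_gprimeTorus_iff L α S' hα hS' hc₀]
  exact ⟨fun ⟨c, hc⟩ => ⟨c, hc.symm⟩, fun ⟨c, hc⟩ => ⟨c, hc.symm⟩⟩

/-- `T_{S′}` is the RANGE of the chart homomorphism (the closure in its definition is redundant). [cite: Rogawski1990, §3.6 p. 31] -/
theorem chartTorusG_eq_range (hα : ∀ i, α i ≠ 0) (hS' : ∀ w, w ∈ S' → w ∈ splitChartPlaces L α) :
    chartTorusG L α S' = (gprimeTorusHom L α S').range := by
  ext t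
  rw [mem_chartTorusG_iff L α S' hα hS']
  constructor
  · rintro ⟨c, hc⟩; exact ⟨Multiplicative.ofAdd c, hc⟩
  · rintro ⟨c, hc⟩; exact ⟨Multiplicative.toAdd c, hc⟩

end Range

/-! ## §3 `chartOrbG` is even in `x_w` -/

section Even

variable (L : Type) [Field L] [NumberField L] [IsCMField L] (α : Fin 3 → L)
  [MeasurableSpace ↥(arch (↥(maximalRealSubfield L)) L (IsCMField.complexConj L) 3 (Matrix.diagonal α))] [BorelSpace ↥(arch (↥(maximalRealSubfield L)) L (IsCMField.complexConj L) 3 (Matrix.diagonal α))]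
  (ν' : Measure ↥(arch (↥(maximalRealSubfield L)) L (IsCMField.complexConj L) 3 (Matrix.diagonal α))) [ν'.IsHaarMeasure] [ν'.IsMulRightInvariant]
  (S' : Finset {w : InfinitePlace L // IsComplex w})

/-- **`chartOrbG` IS INVARIANT UNDER THE REALISED REFLECTION `x_w ↦ −x_w` OF A SPLIT PLACE** (`w ∈ S′` admissible, `α_i ≠ 0`) — for EVERY coordinate `c`, every `a′`, every Haar
`ν′`: `chartOrbG ν′ S′ a′ (negXAt w c) = chartOrbG ν′ S′ a′ c`.  The reflection is conjugation by an involution `g` (★ `exists_involutive_conj_gprimeTorus_negXAt`); `g` normalises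
`T_{S′}` and `Ad(g)` is involutive there, so ★ `integral_descConj_conj_eq'` applies; the box-mass prefactor is unchanged.  The split half of clause (W) of ★ `ArchHCSpaceG` for the
genuine family (★ `archRG` is even in `x_w`). [cite: Shelstad1979, §4 pp. 22–23] [cite: Rogawski1990, §3.6 p. 31; §8.2 p. 122] [cite: DeitmarEchterhoff2014, Thm. 1.5.3] -/
theorem chartOrbG_negXAt (hα : ∀ i, α i ≠ 0) (hS' : ∀ w, w ∈ S' → w ∈ splitChartPlaces L α) {w : {w : InfinitePlace L // IsComplex w}} (hw : w ∈ S')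
    (a' : ↥(arch (↥(maximalRealSubfield L)) L (IsCMField.complexConj L) 3 (Matrix.diagonal α)) → ℂ) (c : {w : InfinitePlace L // IsComplex w} → Fin 3 → ℝ) :
    chartOrbG L α ν' S' a' (negXAt w c) = chartOrbG L α ν' S' a' c := by
  letI : MeasurableSpace (↥(arch (↥(maximalRealSubfield L)) L (IsCMField.complexConj L) 3 (Matrix.diagonal α)) ⧸ chartTorusG L α S') := borel _
  haveI : BorelSpace (↥(arch (↥(maximalRealSubfield L)) L (IsCMField.complexConj L) 3 (Matrix.diagonal α)) ⧸ chartTorusG L α S') := ⟨rfl⟩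
  haveI := isHaarMeasure_chartHaarG L α S'
  haveI := isInvInvariant_chartHaarG L α S'
  obtain ⟨n, hnn, hconj⟩ := exists_involutive_conj_gprimeTorus_negXAt L α hw (hS' w hw)
  have hninv : n⁻¹ = n := inv_eq_of_mul_eq_one_right hnn
  -- `n` normalises `T_{S′}`
  have hnT : ∀ g, n * g * n⁻¹ ∈ chartTorusG L α S' ↔ g ∈ chartTorusG L α S' := by
    intro g
    constructor
    · intro hg
      obtain ⟨c', hc'⟩ := (mem_chartTorusG_iff L α S' hα hS' _).mp hg
      have hg' : g = n * gprimeTorus L α S' c' * n⁻¹ := by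
        rw [hc', hninv, ← mul_assoc, ← mul_assoc, hnn, one_mul, mul_assoc, hnn, mul_one]
      rw [hg', hconj c']
      exact gprimeTorus_mem_chartTorusG L α S' _
    · intro hg
      obtain ⟨c', hc'⟩ := (mem_chartTorusG_iff L α S' hα hS' _).mp hg
      rw [← hc', hconj c']
      exact gprimeTorus_mem_chartTorusG L α S' _
  -- `Ad(n)` is an involution of `T_{S′}`
  have h2 : ∀ x : ↥(chartTorusG L α S'), n * (n * (x : ↥(arch (↥(maximalRealSubfield L)) L (IsCMField.complexConj L) 3 (Matrix.diagonal α))) * n⁻¹) * n⁻¹ = x := fun x => by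
    rw [hninv, ← mul_assoc, ← mul_assoc, hnn, one_mul, mul_assoc, hnn, mul_one]
  have ht := map_conj_eq_self_of_conj_conj_eq (chartTorusG L α S') (chartHaarG L α S') hnT (isClosed_chartTorusG L α S') h2
  -- the point `gprimeTorus S′ (negXAt w c) = n · gprimeTorus S′ c · n⁻¹`
  have hint : descConj (gprimeTorus L α S' (negXAt w c)) (chartTorusG L α S') (forall_mem_chartTorusG_comm L α S' (negXAt w c)) a' =
      descConj (n * gprimeTorus L α S' c * n⁻¹) (chartTorusG L α S')
        (fun g hg => by rw [hconj c]; exact forall_mem_chartTorusG_comm L α S' (negXAt w c) g hg) a' := by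
    funext y
    induction y using QuotientGroup.induction_on with
    | H g => rw [descConj_mk, descConj_mk, hconj c]
  rw [chartOrbG_def, chartOrbG_def, hint]
  congr 1
  exact integral_descConj_conj_eq' (chartTorusG L α S') (isClosed_chartTorusG L α S') (chartHaarG L α S') ν' hnT ht
    (forall_mem_chartTorusG_comm L α S' c) _ a'

end Even

/-! ## §4 (ED. 2) The `G′` box image is fundamental: lattice translates cover `T_{S′}`; Baire ⇒ nonempty interior ⇒ positive mass (mirror of ★ B2 §2) -/

section Box

open scoped Pointwise

variable (L : Type) [Field L] [NumberField L] [IsCMField L] (α : Fin 3 → L) (S' : Finset {w : InfinitePlace L // IsComplex w})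

/-- **The lattice translates of the `G′` box image cover `T_{S′}`** (`α_i ≠ 0`, `S′` admissible; ★ `exists_sub_mem_chartBox` + `mem_chartTorusG_iff`). [cite: Folland1995, §2.2] -/
theorem iUnion_smul_chartBoxImgG_eq_univ (hα : ∀ i, α i ≠ 0) (hS' : ∀ w, w ∈ S' → w ∈ splitChartPlaces L α) :
    (⋃ n : {w : InfinitePlace L // IsComplex w} → Fin 3 → ℤ,
      (⟨gprimeTorus L α S' (fun w i => (n w i : ℝ) * (if w ∈ S' ∧ i = 0 then 1 else 2 * Real.pi)), gprimeTorus_mem_chartTorusG L α S' _⟩ : ↥(chartTorusG L α S')) •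
        chartBoxImgG L α S') = Set.univ := by
  refine Set.eq_univ_of_forall fun t => ?_
  obtain ⟨c, hc⟩ := (mem_chartTorusG_iff L α S' hα hS' t.1).mp t.2
  obtain ⟨n, hn⟩ := exists_sub_mem_chartBox L S' c
  refine Set.mem_iUnion.mpr ⟨n, ?_⟩
  refine ⟨⟨gprimeTorus L α S' (c - fun w i => (n w i : ℝ) * (if w ∈ S' ∧ i = 0 then 1 else 2 * Real.pi)), gprimeTorus_mem_chartTorusG L α S' _⟩,
    ⟨_, hn, rfl⟩, ?_⟩
  apply Subtype.ext
  show gprimeTorus L α S' _ * gprimeTorus L α S' _ = t.1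
  rw [← gprimeTorus_add, add_sub_cancel, hc]

/-- **THE `G′` BOX IMAGE HAS NONEMPTY INTERIOR IN `T_{S′}`** (Baire: countably many closed translates cover the locally compact Hausdorff `T_{S′}`). [cite: Folland1995, §2.2] -/
theorem nonempty_interior_chartBoxImgG (hα : ∀ i, α i ≠ 0) (hS' : ∀ w, w ∈ S' → w ∈ splitChartPlaces L α) : (interior (chartBoxImgG L α S')).Nonempty := by
  haveI := locallyCompactSpace_chartTorusG L α S'
  obtain ⟨n, hn⟩ := nonempty_interior_of_iUnion_of_closed (fun n => ((isCompact_chartBoxImgG L α S').smul _).isClosed) (iUnion_smul_chartBoxImgG_eq_univ L α S' hα hS')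
  rw [interior_smul] at hn
  exact Set.smul_set_nonempty.mp hn

variable [MeasurableSpace ↥(arch (↥(maximalRealSubfield L)) L (IsCMField.complexConj L) 3 (Matrix.diagonal α))]

/-- **Every measure positive on open sets gives the `G′` box image positive mass** — every Haar measure on `T_{S′}`, in particular the frame's transported centraliser measure: the
junction scalar of ★ `classOrbitalIntegral_mul_measure_box_eq_chartOrbG` is NON-ZERO. [cite: Folland1995, §2.2] -/
theorem measure_chartBoxImgG_pos (hα : ∀ i, α i ≠ 0) (hS' : ∀ w, w ∈ S' → w ∈ splitChartPlaces L α) (t : Measure ↥(chartTorusG L α S')) [t.IsOpenPosMeasure] :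
    0 < t (chartBoxImgG L α S') :=
  t.measure_pos_of_nonempty_interior (nonempty_interior_chartBoxImgG L α S' hα hS')

variable [BorelSpace ↥(arch (↥(maximalRealSubfield L)) L (IsCMField.complexConj L) 3 (Matrix.diagonal α))]

/-- **`0 < dt′(B′)`: the prefactor of ★ `chartOrbG` is a genuine positive real** (with ★ `chartHaarG_chartBoxImgG_lt_top`). [cite: Folland1995, §2.2] -/
theorem chartHaarG_chartBoxImgG_pos (hα : ∀ i, α i ≠ 0) (hS' : ∀ w, w ∈ S' → w ∈ splitChartPlaces L α) : 0 < chartHaarG L α S' (chartBoxImgG L α S') :=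
  haveI := isOpenPosMeasure_chartHaarG L α S'
  measure_chartBoxImgG_pos L α S' hα hS' _

/-- The prefactor as a real number is positive. [cite: Folland1995, §2.2] -/
theorem toReal_chartHaarG_chartBoxImgG_pos (hα : ∀ i, α i ≠ 0) (hS' : ∀ w, w ∈ S' → w ∈ splitChartPlaces L α) :
    0 < (chartHaarG L α S' (chartBoxImgG L α S')).toReal :=
  ENNReal.toReal_pos (chartHaarG_chartBoxImgG_pos L α S' hα hS').ne' (chartHaarG_chartBoxImgG_lt_top L α S').ne

end Box

/-! ## §5 (ED. 3) `chartOrbG` is invariant under ANY coordinate move realised by an involution of `G′_∞` -/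

section Involution

variable (L : Type) [Field L] [NumberField L] [IsCMField L] (α : Fin 3 → L)
  [MeasurableSpace ↥(arch (↥(maximalRealSubfield L)) L (IsCMField.complexConj L) 3 (Matrix.diagonal α))] [BorelSpace ↥(arch (↥(maximalRealSubfield L)) L (IsCMField.complexConj L) 3 (Matrix.diagonal α))]
  (ν' : Measure ↥(arch (↥(maximalRealSubfield L)) L (IsCMField.complexConj L) 3 (Matrix.diagonal α))) [ν'.IsHaarMeasure] [ν'.IsMulRightInvariant]
  (S' : Finset {w : InfinitePlace L // IsComplex w})

/-- **`chartOrbG` IS INVARIANT UNDER EVERY COORDINATE MOVE `φ` REALISED BY AN INVOLUTION `g ∈ G′_∞`** (`g · g = 1`, `g · gprimeTorus c · g⁻¹ = gprimeTorus (φ c)` for all `c`;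
`α_i ≠ 0`, `S′` admissible, Haar `ν′`): `chartOrbG ν′ S′ a′ (φ c) = chartOrbG ν′ S′ a′ c` for EVERY `c`, `a′` — `g` normalises `T_{S′}` (★ `mem_chartTorusG_iff`), `Ad(g)` is involutive
there so `Ad(g)_* dt′ = dt′` (★ `map_conj_eq_self_of_conj_conj_eq`), and ★ `integral_descConj_conj_eq'`.  Instances: the split reflection `negXAt w` (★ (NEGX-CONJ), §3) and the compact
same-sign swaps `c ↦ update c w (c w ∘ swap i j)` (★ (SWAP-CONJ), LH4-p01) — the two generators of the REALISED Weyl group of the chart. [cite: Shelstad1979, §4 pp. 22–23]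
[cite: Rogawski1990, §3.6 p. 31] [cite: DeitmarEchterhoff2014, Thm. 1.5.3] -/
theorem chartOrbG_eq_of_involutive_conj (hα : ∀ i, α i ≠ 0) (hS' : ∀ w, w ∈ S' → w ∈ splitChartPlaces L α)
    {g : ↥(arch (↥(maximalRealSubfield L)) L (IsCMField.complexConj L) 3 (Matrix.diagonal α))} (hgg : g * g = 1) {φ : ({w : InfinitePlace L // IsComplex w} → Fin 3 → ℝ) → ({w : InfinitePlace L // IsComplex w} → Fin 3 → ℝ)} (hconj : ∀ c, g * gprimeTorus L α S' c * g⁻¹ = gprimeTorus L α S' (φ c))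
    (a' : ↥(arch (↥(maximalRealSubfield L)) L (IsCMField.complexConj L) 3 (Matrix.diagonal α)) → ℂ) (c : {w : InfinitePlace L // IsComplex w} → Fin 3 → ℝ) :
    chartOrbG L α ν' S' a' (φ c) = chartOrbG L α ν' S' a' c := by
  letI : MeasurableSpace (↥(arch (↥(maximalRealSubfield L)) L (IsCMField.complexConj L) 3 (Matrix.diagonal α)) ⧸ chartTorusG L α S') := borel _
  haveI : BorelSpace (↥(arch (↥(maximalRealSubfield L)) L (IsCMField.complexConj L) 3 (Matrix.diagonal α)) ⧸ chartTorusG L α S') := ⟨rfl⟩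
  haveI := isHaarMeasure_chartHaarG L α S'
  haveI := isInvInvariant_chartHaarG L α S'
  have hginv : g⁻¹ = g := inv_eq_of_mul_eq_one_right hgg
  have hnT : ∀ x, g * x * g⁻¹ ∈ chartTorusG L α S' ↔ x ∈ chartTorusG L α S' := by
    intro x
    constructor
    · intro hx
      obtain ⟨c', hc'⟩ := (mem_chartTorusG_iff L α S' hα hS' _).mp hx
      have hx' : x = g * gprimeTorus L α S' c' * g⁻¹ := by
        rw [hc', hginv, ← mul_assoc, ← mul_assoc, hgg, one_mul, mul_assoc, hgg, mul_one]
      rw [hx', hconj c']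
      exact gprimeTorus_mem_chartTorusG L α S' _
    · intro hx
      obtain ⟨c', hc'⟩ := (mem_chartTorusG_iff L α S' hα hS' _).mp hx
      rw [← hc', hconj c']
      exact gprimeTorus_mem_chartTorusG L α S' _
  have h2 : ∀ x : ↥(chartTorusG L α S'), g * (g * (x : ↥(arch (↥(maximalRealSubfield L)) L (IsCMField.complexConj L) 3 (Matrix.diagonal α))) * g⁻¹) * g⁻¹ = x := fun x => by
    rw [hginv, ← mul_assoc, ← mul_assoc, hgg, one_mul, mul_assoc, hgg, mul_one]
  have ht := map_conj_eq_self_of_conj_conj_eq (chartTorusG L α S') (chartHaarG L α S') hnT (isClosed_chartTorusG L α S') h2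
  have hint : descConj (gprimeTorus L α S' (φ c)) (chartTorusG L α S') (forall_mem_chartTorusG_comm L α S' (φ c)) a' =
      descConj (g * gprimeTorus L α S' c * g⁻¹) (chartTorusG L α S')
        (fun x hx => by rw [hconj c]; exact forall_mem_chartTorusG_comm L α S' (φ c) x hx) a' := by
    funext y
    induction y using QuotientGroup.induction_on with
    | H x => rw [descConj_mk, descConj_mk, hconj c]
  rw [chartOrbG_def, chartOrbG_def, hint]
  congr 1
  exact integral_descConj_conj_eq' (chartTorusG L α S') (isClosed_chartTorusG L α S') (chartHaarG L α S') ν' hnT ht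
    (forall_mem_chartTorusG_comm L α S' c) _ a'

end Involution

/-! ## §6 (ED. 3) `chartOrbG` is invariant under the REALISED compact swaps (same-sign slots) -/

section Swap

variable (L : Type) [Field L] [NumberField L] [IsCMField L] (α : Fin 3 → L)
  [MeasurableSpace ↥(arch (↥(maximalRealSubfield L)) L (IsCMField.complexConj L) 3 (Matrix.diagonal α))] [BorelSpace ↥(arch (↥(maximalRealSubfield L)) L (IsCMField.complexConj L) 3 (Matrix.diagonal α))]
  (ν' : Measure ↥(arch (↥(maximalRealSubfield L)) L (IsCMField.complexConj L) 3 (Matrix.diagonal α))) [ν'.IsHaarMeasure] [ν'.IsMulRightInvariant]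
  (S' : Finset {w : InfinitePlace L // IsComplex w})

/-- **`chartOrbG` IS INVARIANT UNDER THE SWAP OF TWO SAME-SIGN SLOTS AT A COMPACT PLACE** (`w ∉ S′`, `formSign (lineOf i) = formSign (lineOf j)` — the compact reflection, REALISED
in `G′_w`; `α` real at `w`, `α_i ≠ 0`, `S′` admissible, Haar `ν′`): `chartOrbG ν′ S′ a′ (update c w (c w ∘ swap i j)) = chartOrbG ν′ S′ a′ c` for EVERY `c` (= ★ `hcSwapAt w i j c` by `rfl`)
— ★ (SWAP-CONJ) `exists_involutive_conj_gprimeTorus_swap` (LH4-p01) fed to `chartOrbG_eq_of_involutive_conj`.  The compact-swap half of clause (W) for the genuine family.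
[cite: Shelstad1979, §4 p. 23] [cite: Rogawski1990, §3.6 p. 31] [cite: Knapp1986, Ch. V §3] -/
theorem chartOrbG_swap (hα : ∀ i, α i ≠ 0) (hS' : ∀ w, w ∈ S' → w ∈ splitChartPlaces L α) {w : {w : InfinitePlace L // IsComplex w}} (hreal : ∀ k, (w.1.embedding (α k)).im = 0) (hw : w ∉ S')
    (i j : Fin 3) (hs : formSign L α w (lineOf (formSign L α w) i) = formSign L α w (lineOf (formSign L α w) j)) (a' : ↥(arch (↥(maximalRealSubfield L)) L (IsCMField.complexConj L) 3 (Matrix.diagonal α)) → ℂ) (c : {w : InfinitePlace L // IsComplex w} → Fin 3 → ℝ) :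
    chartOrbG L α ν' S' a' (Function.update c w (c w ∘ Equiv.swap i j)) = chartOrbG L α ν' S' a' c := by
  obtain ⟨g, hgg, hconj⟩ := exists_involutive_conj_gprimeTorus_swap L α hα hreal hw i j hs
  exact chartOrbG_eq_of_involutive_conj L α ν' S' hα hS' hgg (φ := fun c => Function.update c w (c w ∘ Equiv.swap i j)) hconj a' c

end Swap

end Literature.NumberTheory.Automorphic.UnitaryGroup

end
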